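import Summits.MatrixMultiplication.OmegaCensus.TwoGenBox

/-!
# ω-census, family (b3): conjecture C9 (b) — PRESCRIBED-POWER BOXES: `R ⋊_u ℤ/q` from a certificate on `u^0 x, …, u^E x`

HONEST FRAMING (pub-omega census; verbatim): lottery ticket; floor = certified bounds/negative ranges.
Census BOOKKEEPING (conjecture C9 of the cell, STRUCTURE.md §2, `BoxRatioSectionLaw`; pub-omega stpp-1 gen 23, the atom lane).
Nothing here is progress on `ω`.

GENERALISES `TwoGenBox`.  A SHAPE `S = (ea, eb, m, n)` is the box `Y = {a^{m_i x} b^{ea_i}}`, `W = {a^{n_j x} b^{eb_j}}` of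
`R ⋊_u ℤ/q` (`RingMetaCyclic.RBox`).  If every exponent sum `ea_i + eb_j` is `≤ E < q`, the `72` forbidden differences are
`dd c c' = u^{ea_i+eb_j'}(m_{i'} − n_j)x + u^{ea_i+eb_j} n_{j'} x − u^{ea_i'+eb_j'} m_i x ∈ ℤ u^0 x + ⋯ + ℤ u^E x`, so for an
additive `λ : R → P` with PRESCRIBED values `λ (u^e x) = s_e` (`e ≤ E`) one has `λ (dd c c') = S.delta s c c'` (`Shape.lam_dd`),
a quantity that no longer mentions `R`, `u` or `q`.  Hence (`Shape.not_boxUseful`) a finite certificate — column sets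
`A_c ⊆ P` avoiding the `S.delta s c c'` with `9|P| ≤ 5 Σ #A_c` — makes `R ⋊_u ℤ/q` box-useless for EVERY finite commutative
ring `R`, every `q > E` and every `u, x` for which such a surjective `λ` exists, i.e. (over `P = 𝔽_p^m`) whenever
`x, u x, …, u^E x` are `𝔽_p`-linearly independent; `Shape.lt_q_of_fun` records that the functional hypothesis forces `E < q`.
This is the engine for the primes the two-generator intervals cannot serve (`p = 2, 3, 7, 13, 19`: certificates in
`PowBoxSmall`), and for any future per-prime certificate.  (The same coefficient law underlies kernel-l4's three-generator line.)
-/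

namespace Summit.MatrixMultiplication.OmegaCensus

open Finset ProductBoxBound

namespace PowBox

/-- A box SHAPE: `b`-exponents `ea, eb` and `x`-coefficients `m, n` of `Y = {a^{m_i x} b^{ea_i}}`, `W = {a^{n_j x} b^{eb_j}}`.
[folklore] -/
structure Shape where
  /-- `b`-exponents of the three `Y`-elements -/
  ea : Fin 3 → ℕ
  /-- `b`-exponents of the three `W`-elements -/
  eb : Fin 3 → ℕ
  /-- `x`-coefficients of the three `Y`-elements -/
  m : Fin 3 → ℤ
  /-- `x`-coefficients of the three `W`-elements -/
  n : Fin 3 → ℤ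

variable {R : Type*} [CommRing R]

/-- The box of a shape in `R ⋊_u ℤ/q` at the element `x`. [folklore] -/
def Shape.box (S : Shape) (q : ℕ) (x : R) : RCyc.RBox R q :=
  ⟨fun i => (S.m i : R) * x, fun i => ((S.ea i : ℕ) : ZMod q), fun j => (S.n j : R) * x, fun j => ((S.eb j : ℕ) : ZMod q)⟩

/-- The prescribed image of `dd c c'`: `(m_{i'} − n_j)·s(ea_i + eb_{j'}) + n_{j'}·s(ea_i + eb_j) − m_i·s(ea_{i'} + eb_{j'})`.
[folklore] -/
def Shape.delta (S : Shape) {P : Type*} [AddCommGroup P] (s : ℕ → P) (c c' : Fin 3 × Fin 3) : P :=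
  (S.m c'.1 - S.n c.2) • s (S.ea c.1 + S.eb c'.2) + S.n c'.2 • s (S.ea c.1 + S.eb c.2) - S.m c.1 • s (S.ea c'.1 + S.eb c'.2)

variable {q : ℕ} {u : R} {x : R} {P : Type*} [AddCommGroup P]

/-- `u^{(e : ZMod q)} = u^e` for `e < q`. [folklore] -/
theorem act_natCast {e : ℕ} (he : e < q) : RCyc.act u ((e : ℕ) : ZMod q) = u ^ e := by
  rw [RCyc.act, ZMod.val_natCast, Nat.mod_eq_of_lt he]

/-- **Coefficient law.** With all exponent sums `≤ E < q` and `λ (u^e x) = s_e` for `e ≤ E`: `λ (dd c c') = S.delta s c c'`.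
[folklore] -/
theorem Shape.lam_dd [NeZero q] [Fact (u ^ q = 1)] (S : Shape) {E : ℕ} (hE : ∀ i j, S.ea i + S.eb j ≤ E) (hEq : E < q)
    (lam : R →+ P) (s : ℕ → P) (hs : ∀ e, e ≤ E → lam (u ^ e * x) = s e) (c c' : Fin 3 × Fin 3) :
    lam ((S.box q x).dd u c c') = S.delta s c c' := by
  have hact : ∀ i j, RCyc.act u (((S.ea i : ℕ) : ZMod q) + ((S.eb j : ℕ) : ZMod q)) = u ^ (S.ea i + S.eb j) := by
    intro i j; rw [← Nat.cast_add, act_natCast (lt_of_le_of_lt (hE i j) hEq)]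
  have key : ∀ (e : ℕ) (k : ℤ), e ≤ E → lam (u ^ e * ((k : R) * x)) = k • s e := by
    intro e k he; rw [mul_left_comm, ← zsmul_eq_mul, map_zsmul, hs e he]
  have e1 : (S.box q x).dd u c c' = u ^ (S.ea c.1 + S.eb c'.2) * (((S.m c'.1 - S.n c.2 : ℤ) : R) * x)
      + u ^ (S.ea c.1 + S.eb c.2) * (((S.n c'.2 : ℤ) : R) * x) - u ^ (S.ea c'.1 + S.eb c'.2) * (((S.m c.1 : ℤ) : R) * x) := by
    simp only [RCyc.RBox.dd, Shape.box, hact, Int.cast_sub]; ring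
  rw [e1, map_sub, map_add, key _ _ (hE _ _), key _ _ (hE _ _), key _ _ (hE _ _), Shape.delta]

/-- Nondegeneracy: distinct `Y`-elements and distinct `W`-elements, from exponents `< q` and a separating criterion on the
coefficients. [folklore] -/
theorem Shape.box_nondeg (S : Shape) (hqa : ∀ i, S.ea i < q) (hqb : ∀ j, S.eb j < q)
    (hy : ∀ i i', i ≠ i' → S.ea i ≠ S.ea i' ∨ (S.m i : R) * x ≠ (S.m i' : R) * x)
    (hw : ∀ j j', j ≠ j' → S.eb j ≠ S.eb j' ∨ (S.n j : R) * x ≠ (S.n j' : R) * x) : (S.box q x).Nondeg u := by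
  have hcast : ∀ e e' : ℕ, e < q → e' < q → ((e : ℕ) : ZMod q) = ((e' : ℕ) : ZMod q) → e = e' := by
    intro e e' he he' h
    have := congrArg ZMod.val h
    rwa [ZMod.val_natCast, ZMod.val_natCast, Nat.mod_eq_of_lt he, Nat.mod_eq_of_lt he'] at this
  refine (S.box q x).nondeg_of u ?_ ?_
  · intro i i' h
    simp only [Shape.box, Prod.mk.injEq] at h
    by_contra hii
    rcases hy i i' hii with h1 | h1
    · exact h1 (hcast _ _ (hqa i) (hqa i') h.2)
    · exact h1 h.1
  · intro j j' h
    simp only [Shape.box, Prod.mk.injEq] at h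
    by_contra hjj
    rcases hw j j' hjj with h1 | h1
    · exact h1 (hcast _ _ (hqb j) (hqb j') h.2)
    · exact h1 h.1

/-- With `λ₁ x = 1` in `ZMod p`: `m x ≠ m' x` whenever `p ∤ m − m'`. [folklore] -/
theorem ne_of_not_dvd {p : ℕ} (lam1 : R →+ ZMod p) (h1 : lam1 x = 1) {m m' : ℤ} (h : ¬ (p : ℤ) ∣ m - m') :
    (m : R) * x ≠ (m' : R) * x := by
  intro e
  apply h
  have e' := congrArg lam1 e
  rw [← zsmul_eq_mul, ← zsmul_eq_mul, map_zsmul, map_zsmul, h1] at e'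
  rw [← ZMod.intCast_zmod_eq_zero_iff_dvd, Int.cast_sub, sub_eq_zero]
  simpa using e'

/-- **Certificate theorem for prescribed-power boxes.**  Shape `S` with exponent sums `≤ E < q`; a surjective additive
`λ : R → P` with `λ (u^e x) = s_e` (`e ≤ E`); a functional `λ₁ : R → 𝔽_p` with `λ₁ x = 1` and the decidable separating
criterion on the shape; column sets `A_c ⊆ P` avoiding every `S.delta s c c'` (`c ≠ c'`) with `9|P| ≤ 5 Σ_c #A_c`.  Then
`R ⋊_u ℤ/q` is not box-useful. [folklore] -/
theorem Shape.not_boxUseful [Fintype R] [DecidableEq R] [NeZero q] [Fact (u ^ q = 1)] [Fintype P] [DecidableEq P]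
    (S : Shape) {E : ℕ} (hE : ∀ i j, S.ea i + S.eb j ≤ E) (hEq : E < q) (x : R) (lam : R →+ P)
    (hlam : Function.Surjective lam) (s : ℕ → P) (hs : ∀ e, e ≤ E → lam (u ^ e * x) = s e)
    {p : ℕ} (lam1 : R →+ ZMod p) (h1 : lam1 x = 1)
    (hy : ∀ i i', i ≠ i' → S.ea i ≠ S.ea i' ∨ ¬ (p : ℤ) ∣ S.m i - S.m i')
    (hw : ∀ j j', j ≠ j' → S.eb j ≠ S.eb j' ∨ ¬ (p : ℤ) ∣ S.n j - S.n j')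
    (A : Fin 3 × Fin 3 → Finset P) (hsep : ∀ c c', c ≠ c' → ∀ z ∈ A c, ∀ z' ∈ A c', z - z' ≠ S.delta s c c')
    (hbig : 9 * Fintype.card P ≤ 5 * ∑ c, #(A c)) : ¬ BoxUseful (RCyc R q u) := by
  have hqa : ∀ i, S.ea i < q := fun i => lt_of_le_of_lt ((Nat.le_add_right _ _).trans (hE i 0)) hEq
  have hqb : ∀ j, S.eb j < q := fun j => lt_of_le_of_lt ((Nat.le_add_left _ _).trans (hE 0 j)) hEq
  have hD := S.box_nondeg (u := u) hqa hqb
    (fun i i' h => (hy i i' h).imp_right (ne_of_not_dvd lam1 h1))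
    (fun j j' h => (hw j j' h).imp_right (ne_of_not_dvd lam1 h1))
  exact (S.box q x).not_boxUseful_of_lamPattern hD lam hlam A (S.delta s) (fun c c' _ => S.lam_dd hE hEq lam s hs c c')
    hsep hbig

/-- The functional hypothesis «every value vector on `x, u x, …, u^E x` is realised by an additive `λ : R → 𝔽_p`» forces
`E < q`. [folklore] -/
theorem lt_q_of_fun [NeZero q] [Fact (u ^ q = 1)] {p : ℕ} [Fact p.Prime] {E : ℕ}
    (hfun : ∀ t : ℕ → ZMod p, ∃ lam : R →+ ZMod p, ∀ e, e ≤ E → lam (u ^ e * x) = t e) : E < q := by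
  by_contra h
  push Not at h
  obtain ⟨lam, hl⟩ := hfun (fun e => if e = 0 then 1 else 0)
  have h0 := hl 0 (Nat.zero_le _)
  have hq := hl q h
  rw [(Fact.out : u ^ q = 1), if_neg (NeZero.ne q)] at hq
  rw [pow_zero, if_pos rfl] at h0
  rw [h0] at hq
  exact one_ne_zero hq

/-- From the functional hypothesis: a functional with prescribed values `s` and one with `λ₁ x = 1`. [folklore] -/
theorem fun_data {p : ℕ} {E : ℕ} (hfun : ∀ t : ℕ → ZMod p, ∃ lam : R →+ ZMod p, ∀ e, e ≤ E → lam (u ^ e * x) = t e)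
    (s : ℕ → ZMod p) :
    (∃ lam : R →+ ZMod p, ∀ e, e ≤ E → lam (u ^ e * x) = s e) ∧ ∃ lam1 : R →+ ZMod p, lam1 x = 1 := by
  refine ⟨hfun s, ?_⟩
  obtain ⟨lam1, h⟩ := hfun (fun _ => 1)
  exact ⟨lam1, by simpa using h 0 (Nat.zero_le _)⟩

/-- An additive map to `ZMod p` taking a non-zero value is surjective. [folklore] -/
theorem surjective_of_ne_zero {p : ℕ} [Fact p.Prime] (lam : R →+ ZMod p) (y : R) (hy : lam y ≠ 0) :
    Function.Surjective lam := by
  intro z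
  refine ⟨(((z * (lam y)⁻¹).val : ℕ) : R) * y, ?_⟩
  rw [← nsmul_eq_mul, map_nsmul, nsmul_eq_mul, ZMod.natCast_zmod_val, mul_assoc, inv_mul_cancel₀ hy, mul_one]

end PowBox

end Summit.MatrixMultiplication.OmegaCensus
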